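import Summits.BirchSwinnertonDyer.BirchSwinnertonDyer.Theorems.AdditiveKolyvaginRoadSemistabilityDefectDictionary
import Summits.BirchSwinnertonDyer.BirchSwinnertonDyer.Theorems.AdditiveKolyvaginRoadRamifiedHabitatSignLawIZeroStar
import HarnessLib

/-!
# Route `AdditiveKolyvaginRoad`, crux KS′ `LevelKolyvaginSystemsAdditive` (stmt-BirchSwinnertonDyer-21396), card
# `ramified-toric-habitat` — the card's two SIGN LAWS AS TYPED (sketch binders `Addv W p`, `¬ e ∣ p − 1` /
# `e ∣ p − 1` with `e := W.semistabilityDefectAt p`, `p ∣ d_{K′}`, `OtherBadPrimesSplit` unfolded verbatim),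
# on `E` semistable away from `p` and odd `d_{K′}`, modulo {Modularity, Kellock–Dokchitser Rem. 2.2 at `p`}

Cell `pub/bsd-wall`, width seat `bsd-wall-akr-p2x-w3` g12; `--supports stmt-BirchSwinnertonDyer-21396` (helper).
THEOREMS ONLY; no definition, no named fact, no `sorry`. BSD is not proved by any of this; KS′/KPA′ stay OPEN
at `p² ∣ N`.

The sketch `Cruxes/LevelKolyvaginSystemsAdditive/RamifiedHabitatKuriharaSlotSketch.lean` §1 types the card's
FIRST LEMMA as `RamifiedToricHabitat.SignLawSupercuspidal` / `…SignLawPrincipalSeries` with the local type at the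
additive prime read through Kraus's defect `e := W.semistabilityDefectAt p`. Width seat w2 (g11) proved the sign
law on every potentially good additive Kodaira row for `E` semistable away from `p` and odd `d_{K′}`, with the
type given by the EXPONENT `a = ord Δ(X)` of the chosen `ℤ_p`-minimal model (`…RamifiedHabitatSignLaw*.lean`);
this seat proved Serre's / Kraus's identification of the defect at `p ≥ 5`
(`Literature/…/SemistabilityDefectSerreFormulaProofs.lean`: `e = 12/gcd(12, a)` on the potentially good rows,
`e = 2` on the potentially multiplicative rows, `e = 1` iff semistable, `a ∈ {2,3,4,6,8,9,10}` at an additive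
potentially good `p`) and the dictionary `…SemistabilityDefectDictionary.lean`. Composing the two:

* **`signLawSupercuspidal_of_addv_of_squarefree`** — hypotheses in the sketch's shape: `p ≥ 5`, `Addv W p`,
  `¬ W.semistabilityDefectAt p ∣ p − 1`, `K′` imaginary quadratic with `p ∣ d_{K′}` and `OtherBadPrimesSplit W p d_{K′}`
  (unfolded); plus `N_E = M·p²` with `M` squarefree, `d_{K′}` odd, `hmod`, `hF1`, `hF1'`. Conclusion
  `w(E)·w(E^{(d_{K′})}) = +1`. The sketch's `1 < e` and `d_{K′} < −4` are not needed, and `¬ e ∣ p − 1` by itself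
  excludes the potentially multiplicative rows (`e = 2` there) and type `I₀*` (`e = 2`).
* **`signLawPrincipalSeries_of_addv_of_padicValRat_j_nonneg_of_squarefree`** — `W.semistabilityDefectAt p ∣ p − 1`
  PLUS the potentially-good binder `0 ≤ ord_p j` which the sketch's Prop lacks (it is FALSE on the potentially
  multiplicative rows, evidence #41 / `RAMIFIED-HABITAT-SIGNLAW-NOTE.md`, and there `e = 2 ∣ p − 1` does hold:
  `SemistabilityDefect.semistabilityDefectAt_eq_two_of_addv_of_subM`). Conclusion `= −1`; type `I₀*` (`a = 6`) via
  w2's `RamifiedHabitat.rootNumber_mul_rootNumber_ramifiedTwist_of_six` (which needs `hmod` only).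

What remains between these and the sketch's Props verbatim: other additive primes of `E` (`M` squarefree), even
`d_{K′}`, the named facts {`exists_isNewformOf`, `atkinLehnerEigenvalueAt_eq_localRootNumberAt` for `E`, `E^{(p*)}`},
and — for `SignLawPrincipalSeries` — the misstated potentially multiplicative rows.

References: [cite: Serre1972, §5.6 (p. 312)] [cite: Rohrlich1993Compositio, Prop. 2(iv)] [cite: KellockDokchitser2023, Rem. 2.2].
-/

set_option autoImplicit false
set_option linter.dupNamespace false

noncomputable section

open scoped Classical NumberTheorySymbols

open IsDedekindDomain IsDedekindDomain.HeightOneSpectrum NumberField Rat.HeightOneSpectrum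
  WeierstrassCurve Literature.NumberTheory.EllipticCurves Literature.NumberTheory.EllipticCurves.Rank1Residual
  Literature.NumberTheory.EllipticCurves.ModularForms Literature.NumberTheory.DiophantineGeometry
  IsDiscreteValuationRing

namespace Summit.BirchSwinnertonDyer.BirchSwinnertonDyer.Theorems.AdditiveKoly.SemistabilityDefect

/-! ## The card's sign laws AS TYPED (sketch binders `Addv W p`, `¬ e ∣ p − 1` / `e ∣ p − 1`,
`OtherBadPrimesSplit`), on `E` semistable away from `p` and odd `d_{K′}` -/

section AsTyped

variable {p : ℕ} [Fact p.Prime]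

omit [Fact p.Prime] in
/-- From the sketch's `OtherBadPrimesSplit W p d` (read on `N = M·p²`) to the sign-law files' `hodd`, `htwo`.
[folklore] -/
private theorem split_data_of_otherBadPrimesSplit (W : WeierstrassCurve ℚ) {M : ℕ}
    (hN : W.conductorNorm ℤ = M * p ^ 2) (hpM : ¬ p ∣ M) {d : ℤ}
    (hsplit : ∀ q : ℕ, q.Prime → (q : ℤ) ∣ (W.conductorNorm ℤ : ℤ) → q ≠ p →
      (q ≠ 2 → J(d | q) = 1) ∧ (q = 2 → d % 8 = 1)) :
    (∀ q ∈ M.primeFactors, q ≠ 2 → J(d | q) = 1) ∧ (2 ∣ M → d % 8 = 1) := by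
  have hdvdN : ∀ q : ℕ, q ∣ M → (q : ℤ) ∣ (W.conductorNorm ℤ : ℤ) := fun q hq ↦ by
    rw [hN]; exact_mod_cast dvd_mul_of_dvd_left hq (p ^ 2)
  have hne : ∀ q : ℕ, q ∣ M → q ≠ p := fun q hq h ↦ hpM (h ▸ hq)
  refine ⟨fun q hq hq2 ↦ ?_, fun h2M ↦ ?_⟩
  · exact (hsplit q (Nat.prime_of_mem_primeFactors hq) (hdvdN q (Nat.dvd_of_mem_primeFactors hq))
      (hne q (Nat.dvd_of_mem_primeFactors hq))).1 hq2
  · exact (hsplit 2 Nat.prime_two (hdvdN 2 h2M) (hne 2 h2M)).2 rfl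

/-- **`SignLawSupercuspidal` AS TYPED, on `E` semistable away from `p` and odd `d_{K′}`.** Hypotheses IN
THE SKETCH'S SHAPE (`Cruxes/LevelKolyvaginSystemsAdditive/RamifiedHabitatKuriharaSlotSketch.lean` §1): `p ≥ 5`,
`Addv W p` (additive at `p`, `Literature/…/Rank1Residual/Predicates.lean`), `¬ W.semistabilityDefectAt p ∣ p − 1`,
`K′` imaginary quadratic with `p ∣ d_{K′}` and `OtherBadPrimesSplit W p d_{K′}` (unfolded verbatim); PLUS the
restrictions of the route's sign-law files: `N_E = M·p²` with `M` squarefree (no other additive prime), `d_{K′}`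
odd, and the named facts `hmod` (Modularity) and Kellock–Dokchitser's Rem. 2.2 at `p` for `E`, `E^{(p*)}`
(`hF1`, `hF1'`). CONCLUSION: `w(E)·w(E^{(d_{K′})}) = +1`. The sketch's binders `1 < e` and `d_{K′} < −4` are
not needed. Chain: `Addv` ⟹ the `ℤ_p`-minimal model is additive (`hasAdditiveReduction_minimal_padic_of_not_good_of_not_mult`);
`¬ e ∣ p − 1` ⟹ potentially good (`padicValRat_j_nonneg_of_not_semistabilityDefectAt_dvd`: on the potentially
multiplicative rows `e = 2`); Serre's table `ord Δ(X) ∈ {2,3,4,6,8,9,10}`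
(`toNat_addVal_Δ_minimal_padic_mem_of_hasAdditiveReduction`), `6` excluded since `e = 2` there; then §3.
BSD is not proved by this; KS′/KPA′ stay open. [cite: Serre1972, §5.6 (p. 312)] [cite: Rohrlich1993Compositio, Prop. 2(iv)]
[cite: KellockDokchitser2023, Rem. 2.2] -/
theorem signLawSupercuspidal_of_addv_of_squarefree (W : WeierstrassCurve ℚ) [W.IsElliptic]
    (hmod : exists_isNewformOf) (hF1 : W.atkinLehnerEigenvalueAt_eq_localRootNumberAt)
    (hF1' : (W.quadraticTwist (((-1 : ℤ) ^ (p / 2) * p : ℤ) : ℚ)).atkinLehnerEigenvalueAt_eq_localRootNumberAt)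
    (hp5 : 5 ≤ p) (hadd : Addv W p) (hsc : ¬ W.semistabilityDefectAt p ∣ p - 1)
    {M : ℕ} (hN : W.conductorNorm ℤ = M * p ^ 2) (hM : Squarefree M) (hpM : ¬ p ∣ M)
    (K : Type) [Field K] [NumberField K] (hK : IsImaginaryQuadratic K) (hKodd : Odd (NumberField.discr K))
    (hpd : (p : ℤ) ∣ NumberField.discr K)
    (hsplit : ∀ q : ℕ, q.Prime → (q : ℤ) ∣ (W.conductorNorm ℤ : ℤ) → q ≠ p →
      (q ≠ 2 → J(NumberField.discr K | q) = 1) ∧ (q = 2 → NumberField.discr K % 8 = 1)) :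
    W.rootNumber * (W.quadraticTwist (NumberField.discr K : ℚ)).rootNumber = 1 := by
  have hp : p.Prime := Fact.out
  -- the chosen `ℤ_p`-minimal model `X` is additive and potentially good
  have haddX := W.hasAdditiveReduction_minimal_padic_of_not_good_of_not_mult hadd.1 hadd.2
  obtain ⟨hc₄, hΔne⟩ := W.addVal_ne_zero_of_hasAdditiveReduction_minimal_padic haddX
  have hjQ : 0 ≤ padicValRat p W.j :=
    W.padicValRat_j_nonneg_of_not_semistabilityDefectAt_dvd hp5 hadd.1 hadd.2 hsc
  have hj := (W.padicValRat_j_nonneg_iff_not_addVal_lt).mp hjQ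
  -- the exponent `a = ord Δ(X) ∈ {2,3,4,6,8,9,10}`
  set a : ℕ := (addVal ℤ_[p] (((W.baseChange ℚ_[p]).minimal ℤ_[p]).integralModel ℤ_[p]).Δ).toNat with ha
  have hmem := W.toNat_addVal_Δ_minimal_padic_mem_of_hasAdditiveReduction hp5 haddX hj
  have htop : addVal ℤ_[p] (((W.baseChange ℚ_[p]).minimal ℤ_[p]).integralModel ℤ_[p]).Δ ≠ ⊤ := by
    intro h
    rw [h] at hmem
    simp at hmem
  have hΔ : addVal ℤ_[p] (((W.baseChange ℚ_[p]).minimal ℤ_[p]).integralModel ℤ_[p]).Δ = a := by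
    rw [ha, ENat.coe_toNat htop]
  rw [← ha] at hmem
  -- the habitat data on the primes of `M`
  obtain ⟨hodd, htwo⟩ := split_data_of_otherBadPrimesSplit W hN hpM hsplit
  -- `a = 6` (type I₀*, `e = 2 ∣ p − 1`) is excluded by `hsc`
  have hne6 : a ≠ 6 := by
    intro h6
    apply hsc
    rw [W.semistabilityDefectAt_eq_twelve_div_gcd_of_addVal_eq hp5 hΔ hj, h6]
    have : 12 / Nat.gcd 6 12 = 2 := by decide
    rw [this]
    rcases hp.eq_two_or_odd with h | h <;> omega
  have ha' : a = 2 ∨ a = 3 ∨ a = 4 ∨ a = 8 ∨ a = 9 ∨ a = 10 := by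
    rcases hmem with h | h | h | h | h | h | h
    · exact Or.inl h
    · exact Or.inr (Or.inl h)
    · exact Or.inr (Or.inr (Or.inl h))
    · exact absurd h hne6
    · exact Or.inr (Or.inr (Or.inr (Or.inl h)))
    · exact Or.inr (Or.inr (Or.inr (Or.inr (Or.inl h))))
    · exact Or.inr (Or.inr (Or.inr (Or.inr (Or.inr h))))
  exact rootNumber_mul_rootNumber_twist_discr_eq_one_of_not_semistabilityDefectAt_dvd W hmod hF1 hF1' hp5 hN hM
    hpM hΔ ha' hc₄ hj K hK hKodd hpd hodd htwo hsc

/-- **`SignLawPrincipalSeries` AS TYPED on the POTENTIALLY GOOD rows, `E` semistable away from `p`, odd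
`d_{K′}`.** Hypotheses in the sketch's shape — `p ≥ 5`, `Addv W p`, `W.semistabilityDefectAt p ∣ p − 1`,
`p ∣ d_{K′}`, `OtherBadPrimesSplit W p d_{K′}` — PLUS `0 ≤ ord_p j` (potentially good: the sketch's Prop
lacks it and is FALSE on the potentially multiplicative rows, evidence #41, where `e = 2 ∣ p − 1` does hold,
`semistabilityDefectAt_eq_two_of_addv_of_subM`), `N_E = M·p²` with `M` squarefree, `d_{K′}` odd, and `hmod`;
Kellock–Dokchitser at `p` (`hF1`, `hF1'`) is needed on types II/III/IV/IV*/III*/II* and NOT on `I₀*`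
(w2's `rootNumber_mul_rootNumber_ramifiedTwist_of_six`). CONCLUSION: `w(E)·w(E^{(d_{K′})}) = −1`.
BSD is not proved by this. [cite: Serre1972, §5.6 (p. 312)] [cite: Rohrlich1993Compositio, Prop. 2(iv)]
[cite: KellockDokchitser2023, Rem. 2.2] -/
theorem signLawPrincipalSeries_of_addv_of_padicValRat_j_nonneg_of_squarefree (W : WeierstrassCurve ℚ)
    [W.IsElliptic] (hmod : exists_isNewformOf) (hF1 : W.atkinLehnerEigenvalueAt_eq_localRootNumberAt)
    (hF1' : (W.quadraticTwist (((-1 : ℤ) ^ (p / 2) * p : ℤ) : ℚ)).atkinLehnerEigenvalueAt_eq_localRootNumberAt)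
    (hp5 : 5 ≤ p) (hadd : Addv W p) (hjQ : 0 ≤ padicValRat p W.j) (hps : W.semistabilityDefectAt p ∣ p - 1)
    {M : ℕ} (hN : W.conductorNorm ℤ = M * p ^ 2) (hM : Squarefree M) (hpM : ¬ p ∣ M)
    (K : Type) [Field K] [NumberField K] (hK : IsImaginaryQuadratic K) (hKodd : Odd (NumberField.discr K))
    (hpd : (p : ℤ) ∣ NumberField.discr K)
    (hsplit : ∀ q : ℕ, q.Prime → (q : ℤ) ∣ (W.conductorNorm ℤ : ℤ) → q ≠ p →
      (q ≠ 2 → J(NumberField.discr K | q) = 1) ∧ (q = 2 → NumberField.discr K % 8 = 1)) :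
    W.rootNumber * (W.quadraticTwist (NumberField.discr K : ℚ)).rootNumber = -1 := by
  have hp : p.Prime := Fact.out
  have haddX := W.hasAdditiveReduction_minimal_padic_of_not_good_of_not_mult hadd.1 hadd.2
  obtain ⟨hc₄, hΔne⟩ := W.addVal_ne_zero_of_hasAdditiveReduction_minimal_padic haddX
  have hj := (W.padicValRat_j_nonneg_iff_not_addVal_lt).mp hjQ
  set a : ℕ := (addVal ℤ_[p] (((W.baseChange ℚ_[p]).minimal ℤ_[p]).integralModel ℤ_[p]).Δ).toNat with ha
  have hmem := W.toNat_addVal_Δ_minimal_padic_mem_of_hasAdditiveReduction hp5 haddX hj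
  have htop : addVal ℤ_[p] (((W.baseChange ℚ_[p]).minimal ℤ_[p]).integralModel ℤ_[p]).Δ ≠ ⊤ := by
    intro h
    rw [h] at hmem
    simp at hmem
  have hΔ : addVal ℤ_[p] (((W.baseChange ℚ_[p]).minimal ℤ_[p]).integralModel ℤ_[p]).Δ = a := by
    rw [ha, ENat.coe_toNat htop]
  rw [← ha] at hmem
  obtain ⟨hodd, htwo⟩ := split_data_of_otherBadPrimesSplit W hN hpM hsplit
  by_cases h6 : a = 6
  · -- type I₀*: `hmod` alone
    rw [h6] at hΔ
    obtain ⟨d', hd, hd'4, hd'sq, hgcd, hneg⟩ :=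
      RamifiedHabitat.ramifiedHabitat_data_of_discr (by omega) hM K hK hKodd hpd hodd htwo
    rw [hd] at hodd htwo ⊢
    rw [← hN] at hgcd
    exact RamifiedHabitat.rootNumber_mul_rootNumber_ramifiedTwist_of_six W hmod hp5 hN hM hpM hΔ hc₄ hj hd'4 hd'sq
      hgcd hneg hodd htwo
  · have ha' : a = 2 ∨ a = 3 ∨ a = 4 ∨ a = 8 ∨ a = 9 ∨ a = 10 := by
      rcases hmem with h | h | h | h | h | h | h
      · exact Or.inl h
      · exact Or.inr (Or.inl h)
      · exact Or.inr (Or.inr (Or.inl h))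
      · exact absurd h h6
      · exact Or.inr (Or.inr (Or.inr (Or.inl h)))
      · exact Or.inr (Or.inr (Or.inr (Or.inr (Or.inl h))))
      · exact Or.inr (Or.inr (Or.inr (Or.inr (Or.inr h))))
    exact rootNumber_mul_rootNumber_twist_discr_eq_neg_one_of_semistabilityDefectAt_dvd W hmod hF1 hF1' hp5 hN
      hM hpM hΔ ha' hc₄ hj K hK hKodd hpd hodd htwo hps

end AsTyped

end Summit.BirchSwinnertonDyer.BirchSwinnertonDyer.Theorems.AdditiveKoly.SemistabilityDefect

end
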